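import Summits.Schanuel.Schanuel.Theorems.RootDecomp1KXLinearII01

/-!
# RootDecomp1KXLinearII — lens 1, generation 45, node 3 (g45c) «THE OTHER PLACE AT ∞: ALL x-LINEAR CURVES A(Y) + x·B(Y) WITH B SEPARABLE OVER ℚ, ANY DEGREES, EVERY m₀ ≥ 3» (RULE K-R33 (ii); CLAIM L2288, ACK/CHECKLIST K-g45c L2290 = PRICE THEOREM ×1, NODE L2299; critic VERDICT pending at staging — filed only on GO and only once Literature RidoutRationalsZero builds on the farm) — continuation (RootDecomp1KXLinearII02): §XII part 2 — nearest root, case II closeness, dichotomy arithmetic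

(lens-1 g45c HOME kernel K₃ = HOME/decomp-schanuel-lens-1/g45c/DLxlinear2.lean ce89a773… 4482 l = K₂ (tree: DegreeLadder01–09 + XLinear01–05) + §XII xii_tail.lean 644 l (ns `…RootDecomp1KXLinearII`). Port by census-1 gen 19 as `RootDecomp1KXLinearII01–03` importing tree XLinear05 + Literature RidoutRationalsZero: 01 = the Diophantine input fed BY TREE NAME (`ridout_one (Q) …` with `Ridout.finite_of_abs_le_one` at S = {2}, κ = 5/2; `ridout_window`), `norm_psNumer`, `norm_aeval_le`, `roots_data`; 02 = NEAREST ROOT `nearest_root`, `caseII_close`, `dichotomy_arith`; 03 = `levels_finite_of_B_ne`, `thinFibreAt_xLinear_sep (A B) (hsep : (B.map (Int.castRingHom ℚ)).Separable) (hle : A.natDegree ≤ B.natDegree) (hm : 3 ≤ m₀) : ThinFibreAt m₀ (xLinP A B)` (scoped `maxHeartbeats 400000` as in K), the UNION `thinFibreAt_xLinear_of_sep` (any degrees; case split with the tree's `thinFibreAt_xLinear_of_lt`), instances `thinFibreAt_lineP` (m₀ ≥ 3), `thinFibreAt_fermatTwist`, the consumer `xLinearSep_nonvanishing (hm : 3 ≤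 m) (hρ : SkelLiouvilleFix m ρ) (A B) (hsep) : aeval ρ A + liouvilleNumber 2 * aeval ρ B ≠ 0` — ALL HYPOTHESIS-FREE.
PORT EDITS: the `def PadicRothRat` DELETED and the `(hR : PadicRothRat)` binder REMOVED from the seven decls that carried it, `Literature.NumberTheory.DiophantineApproximation.Ridout.finite_of_abs_le_one` fed directly at the one use site in `ridout_one` (same shape as DegreeLadder09 / XLinear01, critic L2282 (b)/(d)); node-2 primed names re-pointed to the tree's unprimed binder-free forms (`thinFibreAt_xLinear_of_lt`, `xLinear_nonvanishing`); `open …XLinearCore (norm_two …)` ↦ unrestricted open + private copies (those Core lemmas are private in the tree port); linter option dropped; two docstrings added; two generic helpers private; statements and proofs otherwise verbatim. `--supports stmt-Schanuel-33364`; no census credit; rung 0.)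
-/

noncomputable section

namespace Summit.Schanuel.Schanuel.Theorems.RootDecomp1KXLinearII

open Polynomial LiouvilleNumber
open scoped Nat
open Summit.Schanuel.Schanuel.Theorems.RootDecomp1KSkelCell
  (exists_le_two_pow_factorial iota iota_spec iota_le_of_le pow_lt_of_lt_iota lt_iota_of_pow_lt iota_mono
   one_le_iota SkelLiouville SkelLiouvilleFix skelLiouville_iff_fix SkelLiouvilleFix.mono uStar dU rU dU_cast
   two_pow_le_four_mul_dU two_mul_dU_lt one_le_dU rU_den rU_cast uStar_sub_rU skelLiouvilleFix_one_uStar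
   not_skelFixOne_algebraicIndependent)
open Summit.Schanuel.Schanuel.Theorems.RootDecomp1KTwoBaseCell (psNumer partialSum_eq_psNumer_div coprime_psNumer
  algebraicIndependent_of_forall_int')
open Summit.Schanuel.Schanuel.Theorems.RootDecomp1KRelLiouvilleCell (partialSum_two_strictMono
  partialSum_two_lt_liouvilleNumber abs_liouvilleNumber_two_sub_partialSum)
open Summit.Schanuel.Schanuel.Theorems.RootDecomp1KDegreeLadder
open Summit.Schanuel.Schanuel.Theorems.RootDecomp1KXLinearCore
open Summit.Schanuel.Schanuel.Theorems.RootDecomp1KXLinear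

/-- `‖2‖₂ = 1/2` in `PadicAlgCl 2`. -/
private theorem norm_two : ‖(2 : PadicAlgCl 2)‖ = 1 / 2 := by
  have h1 : ((2 : ℕ) : PadicAlgCl 2) = algebraMap ℚ_[2] (PadicAlgCl 2) ((2 : ℕ) : ℚ_[2]) :=
    (map_natCast _ 2).symm
  have h2 : ‖((2 : ℕ) : ℚ_[2])‖ = (↑(2 : ℕ) : ℝ)⁻¹ := Padic.norm_p
  have h3 : ‖((2 : ℕ) : PadicAlgCl 2)‖ = 1 / 2 := by rw [h1, PadicAlgCl.norm_extends, h2]; norm_num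
  simpa using h3

/-- `‖2^t‖₂ = 2^{−t}`. -/
private theorem norm_two_pow (t : ℕ) : ‖(2 : PadicAlgCl 2) ^ t‖ = (1 / 2 : ℝ) ^ t := by
  rw [norm_pow, norm_two]

/-- `‖(z : \overline{ℚ₂})‖ ≤ 1` for integers. -/
private theorem norm_intCast_le_one' (z : ℤ) : ‖(z : PadicAlgCl 2)‖ ≤ 1 := by
  have h1 : (z : PadicAlgCl 2) = algebraMap ℚ_[2] (PadicAlgCl 2) (z : ℚ_[2]) := (map_intCast _ z).symm
  rw [h1, PadicAlgCl.norm_extends]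
  exact Padic.norm_int_le_one z

/-- **Nearest-root lemma** (separable `B`): every `z ∈ ℂ₂` is within `c·‖B(z)‖₂` of some root of `B`. -/
theorem nearest_root (B : ℤ[X]) (hb : 1 ≤ B.natDegree) (hsep : (B.map (Int.castRingHom ℚ)).Separable) :
    ∃ (T : Finset (PadicAlgCl 2)) (c : ℝ), 0 < c ∧ T.card = B.natDegree ∧ (∀ β ∈ T, aeval β B = 0) ∧
      (∀ z : PadicAlgCl 2, aeval z B = (B.leadingCoeff : PadicAlgCl 2) * ∏ β ∈ T, (z - β)) ∧
      ∀ z : PadicAlgCl 2, ∃ β ∈ T, ‖z - β‖ ≤ c * ‖aeval z B‖ := by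
  classical
  have hB : B ≠ 0 := by rintro rfl; simp at hb
  obtain ⟨T, hcard, hroots, hprod⟩ := roots_data B hB hsep
  have hne : T.Nonempty := by rw [← Finset.card_pos, hcard]; exact hb
  have hℓ : (0 : ℝ) < ‖(B.leadingCoeff : PadicAlgCl 2)‖ := by
    rw [norm_pos_iff]; exact_mod_cast leadingCoeff_ne_zero.mpr hB
  set D : PadicAlgCl 2 → ℝ := fun β₀ => ∏ β ∈ T.erase β₀, ‖β₀ - β‖ with hD
  have hDpos : ∀ β₀ ∈ T, 0 < D β₀ := by
    intro β₀ hβ₀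
    apply Finset.prod_pos
    intro β hβ
    rw [norm_pos_iff, sub_ne_zero]
    exact (Finset.ne_of_mem_erase hβ).symm
  set c : ℝ := ∑ β₀ ∈ T, 1 / (‖(B.leadingCoeff : PadicAlgCl 2)‖ * D β₀) with hc
  have hcpos : 0 < c := by
    apply Finset.sum_pos _ hne
    intro β₀ hβ₀
    exact one_div_pos.mpr (mul_pos hℓ (hDpos β₀ hβ₀))
  refine ⟨T, c, hcpos, hcard, hroots, hprod, fun z => ?_⟩
  obtain ⟨β₀, hβ₀T, hmin⟩ := T.exists_min_image (fun β => ‖z - β‖) hne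
  refine ⟨β₀, hβ₀T, ?_⟩
  -- lower bound for the other factors
  have hfac : ∀ β ∈ T.erase β₀, ‖β₀ - β‖ ≤ ‖z - β‖ := by
    intro β hβ
    have hβT : β ∈ T := Finset.mem_of_mem_erase hβ
    have h1 := IsUltrametricDist.norm_add_le_max (z - β) (-(z - β₀))
    rw [norm_neg, ← sub_eq_add_neg, show z - β - (z - β₀) = β₀ - β by ring] at h1
    exact h1.trans (max_le le_rfl (hmin β hβT))
  have hlow : ‖(B.leadingCoeff : PadicAlgCl 2)‖ * (‖z - β₀‖ * D β₀) ≤ ‖aeval z B‖ := by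
    rw [hprod z, norm_mul, norm_prod, ← Finset.mul_prod_erase T (fun β => ‖z - β‖) hβ₀T]
    refine mul_le_mul_of_nonneg_left (mul_le_mul_of_nonneg_left ?_ (norm_nonneg _)) hℓ.le
    exact Finset.prod_le_prod (fun β _ => norm_nonneg _) hfac
  have hkey : ‖z - β₀‖ ≤ 1 / (‖(B.leadingCoeff : PadicAlgCl 2)‖ * D β₀) * ‖aeval z B‖ := by
    have hpos : 0 < ‖(B.leadingCoeff : PadicAlgCl 2)‖ * D β₀ := mul_pos hℓ (hDpos β₀ hβ₀T)
    rw [one_div, ← div_eq_inv_mul, le_div_iff₀ hpos]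
    calc ‖z - β₀‖ * (‖(B.leadingCoeff : PadicAlgCl 2)‖ * D β₀)
        = ‖(B.leadingCoeff : PadicAlgCl 2)‖ * (‖z - β₀‖ * D β₀) := by ring
      _ ≤ ‖aeval z B‖ := hlow
  refine hkey.trans (mul_le_mul_of_nonneg_right ?_ (norm_nonneg _))
  exact Finset.single_le_sum (f := fun β₀ => 1 / (‖(B.leadingCoeff : PadicAlgCl 2)‖ * D β₀))
    (fun β₀ hβ₀ => (one_div_pos.mpr (mul_pos hℓ (hDpos β₀ hβ₀))).le) hβ₀T

/-- **The 2-adic closeness at the place `deg B ≥ deg A`**: beyond a level `N₁`, every point `r` of the level `N` with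
`B(r) ≠ 0` is `c·2^{−N!}`-close (after the harmless factor `lc_B`) to a root of `B` in `ℂ₂`. -/
theorem caseII_close (A B : ℤ[X]) (hb : 1 ≤ B.natDegree) (hsep : (B.map (Int.castRingHom ℚ)).Separable)
    (hle : A.natDegree ≤ B.natDegree) :
    ∃ (T : Finset (PadicAlgCl 2)) (c : ℝ) (N₁ : ℕ), 0 < c ∧ (∀ β ∈ T, aeval β B = 0) ∧
      ∀ N, N₁ ≤ N → ∀ r : ℚ, OnLevel A B N r → aeval r B ≠ 0 →
        ∃ β ∈ T, ‖(B.leadingCoeff : PadicAlgCl 2) * ((r : PadicAlgCl 2) - β)‖ ≤ c * (1 / 2 : ℝ) ^ N ! := by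
  classical
  have hB : B ≠ 0 := by rintro rfl; simp at hb
  obtain ⟨T, c₀, hc₀, hcard, hroots, hprod, hnear⟩ := nearest_root B hb hsep
  set ℓ : PadicAlgCl 2 := (B.leadingCoeff : PadicAlgCl 2) with hℓdef
  have hℓpos : 0 < ‖ℓ‖ := by rw [norm_pos_iff, hℓdef]; exact_mod_cast leadingCoeff_ne_zero.mpr hB
  have hℓle : ‖ℓ‖ ≤ 1 := norm_intCast_le_one' _
  set R₀ : ℝ := 1 + ∑ β ∈ T, ‖β‖ with hR₀
  have hR₀1 : 1 ≤ R₀ := by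
    have : 0 ≤ ∑ β ∈ T, ‖β‖ := Finset.sum_nonneg fun β _ => norm_nonneg β
    linarith
  have hR₀β : ∀ β ∈ T, ‖β‖ < R₀ := by
    intro β hβ
    have := Finset.single_le_sum (f := fun β => ‖β‖) (fun β _ => norm_nonneg β) hβ
    linarith
  obtain ⟨N₁, hN₁⟩ := exists_pow_lt_of_lt_one hℓpos (show (1 / 2 : ℝ) < 1 by norm_num)
  have hR₀pos : 0 < R₀ := lt_of_lt_of_le one_pos hR₀1
  refine ⟨T, c₀ * R₀ ^ A.natDegree, max N₁ 3, mul_pos hc₀ (pow_pos hR₀pos _), hroots,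
    fun N hN r hpt hBr => ?_⟩
  have hN3 : 3 ≤ N := le_trans (le_max_right _ _) hN
  have hNN₁ : N₁ ≤ N := le_trans (le_max_left _ _) hN
  -- the identity `2^{N!}·A(r) = −p_N·B(r)` in `ℂ₂`
  have hq : (2 : ℚ) ^ N ! * aeval r A = -((psNumer 2 N : ℚ) * aeval r B) := by
    have h2 : (2 : ℚ) ^ N ! ≠ 0 := pow_ne_zero _ two_ne_zero
    unfold OnLevel at hpt
    field_simp at hpt
    linarith
  have hc2 : (2 : PadicAlgCl 2) ^ N ! * aeval (r : PadicAlgCl 2) A =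
      -((psNumer 2 N : PadicAlgCl 2) * aeval (r : PadicAlgCl 2) B) := by
    have := congrArg (Rat.cast : ℚ → PadicAlgCl 2) hq
    push_cast at this
    rwa [aeval_ratCast, aeval_ratCast] at this
  have hnB : ‖aeval (r : PadicAlgCl 2) B‖ = (1 / 2 : ℝ) ^ N ! * ‖aeval (r : PadicAlgCl 2) A‖ := by
    have := congrArg (fun w => ‖w‖) hc2
    simp only [norm_mul, norm_neg, norm_two_pow, norm_psNumer hN3, one_mul] at this
    exact this.symm
  -- `‖r‖₂ ≤ R₀`
  have hrR : ‖(r : PadicAlgCl 2)‖ ≤ R₀ := by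
    by_contra hlt
    push Not at hlt
    have hr1 : 1 ≤ ‖(r : PadicAlgCl 2)‖ := hR₀1.trans hlt.le
    have hrpos : 0 < ‖(r : PadicAlgCl 2)‖ := lt_of_lt_of_le one_pos hr1
    have hfac : ∀ β ∈ T, ‖(r : PadicAlgCl 2) - β‖ = ‖(r : PadicAlgCl 2)‖ := by
      intro β hβ
      have hne : ‖(r : PadicAlgCl 2)‖ ≠ ‖-β‖ := by
        rw [norm_neg]; exact ne_of_gt ((hR₀β β hβ).trans hlt)
      rw [sub_eq_add_neg, IsUltrametricDist.norm_add_eq_max_of_norm_ne_norm hne, norm_neg]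
      exact max_eq_left ((hR₀β β hβ).trans hlt).le
    have hBn : ‖aeval (r : PadicAlgCl 2) B‖ = ‖ℓ‖ * ‖(r : PadicAlgCl 2)‖ ^ B.natDegree := by
      rw [hprod, norm_mul, norm_prod, Finset.prod_congr rfl hfac, Finset.prod_const, hcard]
    have hAn : ‖aeval (r : PadicAlgCl 2) A‖ ≤ ‖(r : PadicAlgCl 2)‖ ^ B.natDegree :=
      calc ‖aeval (r : PadicAlgCl 2) A‖ ≤ max 1 ‖(r : PadicAlgCl 2)‖ ^ A.natDegree := norm_aeval_le A _
        _ = ‖(r : PadicAlgCl 2)‖ ^ A.natDegree := by rw [max_eq_right hr1]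
        _ ≤ ‖(r : PadicAlgCl 2)‖ ^ B.natDegree := pow_le_pow_right₀ hr1 hle
    have h1 : ‖ℓ‖ * ‖(r : PadicAlgCl 2)‖ ^ B.natDegree ≤ (1 / 2 : ℝ) ^ N ! * ‖(r : PadicAlgCl 2)‖ ^ B.natDegree := by
      rw [← hBn, hnB]; gcongr
    have h2 : ‖ℓ‖ ≤ (1 / 2 : ℝ) ^ N ! := le_of_mul_le_mul_right h1 (pow_pos hrpos _)
    have h3 : (1 / 2 : ℝ) ^ N ! ≤ (1 / 2 : ℝ) ^ N₁ :=
      pow_le_pow_of_le_one (by norm_num) (by norm_num) (hNN₁.trans (Nat.self_le_factorial N))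
    linarith
  -- conclude with the nearest root
  have hAle : ‖aeval (r : PadicAlgCl 2) A‖ ≤ R₀ ^ A.natDegree :=
    (norm_aeval_le A _).trans (pow_le_pow_left₀ (le_trans zero_le_one (le_max_left _ _)) (max_le hR₀1 hrR) _)
  obtain ⟨β, hβT, hβ⟩ := hnear (r : PadicAlgCl 2)
  refine ⟨β, hβT, ?_⟩
  rw [norm_mul]
  calc ‖ℓ‖ * ‖(r : PadicAlgCl 2) - β‖ ≤ 1 * (c₀ * ‖aeval (r : PadicAlgCl 2) B‖) := by gcongr
    _ = c₀ * ((1 / 2 : ℝ) ^ N ! * ‖aeval (r : PadicAlgCl 2) A‖) := by rw [one_mul, hnB]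
    _ ≤ c₀ * ((1 / 2 : ℝ) ^ N ! * R₀ ^ A.natDegree) := by gcongr
    _ = c₀ * R₀ ^ A.natDegree * (1 / 2 : ℝ) ^ N ! := by ring

/-! ### The numeric end of the dichotomy and the composition -/

/-- an eventual inequality: `G^{N+1} ≤ 2^{(N−5)·N!}` for `N` large. -/
theorem eventually_pow_le (G : ℝ) : ∃ N₂ : ℕ, ∀ N, N₂ ≤ N → G ^ (N + 1) ≤ (2 : ℝ) ^ ((N - 5) * N !) := by
  obtain ⟨m, hm⟩ : ∃ m : ℕ, |G| ≤ 2 ^ m := by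
    obtain ⟨m, hm⟩ := exists_nat_ge |G|
    exact ⟨m, hm.trans (by exact_mod_cast (Nat.lt_two_pow_self).le)⟩
  refine ⟨2 * m + 6, fun N hN => ?_⟩
  have h0 : G ^ (N + 1) ≤ |G| ^ (N + 1) := by rw [← abs_pow]; exact le_abs_self _
  refine h0.trans ?_
  calc |G| ^ (N + 1) ≤ (2 ^ m) ^ (N + 1) := pow_le_pow_left₀ (abs_nonneg G) hm _
    _ = 2 ^ (m * (N + 1)) := by rw [pow_mul]
    _ ≤ 2 ^ ((N - 5) * N !) := by
        apply pow_le_pow_right₀ (by norm_num)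
        obtain ⟨n, rfl⟩ : ∃ n, N = n + 6 := ⟨N - 6, by omega⟩
        have hn : m ≤ n := by omega
        have hf : (n + 6) * (n + 5) ≤ (n + 6)! := by
          have h1 : (n + 6)! = (n + 6) * ((n + 5) * (n + 4)!) := by
            rw [show n + 6 = (n + 5) + 1 by rfl, Nat.factorial_succ, show n + 5 = (n + 4) + 1 by rfl,
              Nat.factorial_succ]
          rw [h1]
          exact Nat.mul_le_mul_left _ (Nat.le_mul_of_pos_right _ (Nat.factorial_pos _))
        have h2 : m * (n + 6 + 1) ≤ n * (n + 7) := by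
          rw [show n + 6 + 1 = n + 7 by rfl]; exact Nat.mul_le_mul_right _ hn
        have h3 : n * (n + 7) ≤ (n + 6 - 5) * ((n + 6) * (n + 5)) := by
          rw [show n + 6 - 5 = n + 1 by omega]
          have h4 : n * (n + 7) ≤ (n + 6) * (n + 5) := by nlinarith
          exact h4.trans (Nat.le_mul_of_pos_left _ (Nat.succ_pos n))
        exact h2.trans (h3.trans (Nat.mul_le_mul_left _ hf))

/-- **The arithmetic end of the dichotomy** (its own lemma): if the root distance `x` of a point is
`≤ c·2^{−N!}` but the Ridout inequality `den^5·x² ≤ 1` FAILS, the denominator wins for `N ≥ N₂(c, C)`: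
`C·2^{(N+1)!} < den^{3N}`.  (With `W = 2^{N!}`: `W² < c²·den^5`; if `den^{3N} ≤ C·W^{N+1}` then
`W^{6N} < c^{6N}·C^5·W^{5N+5}`, i.e. `2^{(N−5)·N!} < C^5·c^{6N} ≤ G^{N+1}` — absurd for `N` large.) -/
theorem dichotomy_arith (c C : ℝ) : ∃ N₂ : ℕ, ∀ N, N₂ ≤ N → ∀ (d : ℕ) (x : ℝ), 1 ≤ d → 0 ≤ x →
    x ≤ c * (1 / 2 : ℝ) ^ N ! → ¬ ((d : ℝ) ^ 5 * x ^ 2 ≤ 1) → C * 2 ^ (N + 1)! < (d : ℝ) ^ (3 * N) := by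
  set G : ℝ := max 1 (max (C ^ 5) (c ^ 6)) with hG
  obtain ⟨N₂, hN₂⟩ := eventually_pow_le G
  refine ⟨max N₂ 6, fun N hN d x hd hx0 hx hnot => ?_⟩
  push Not at hnot
  have hdR : (1 : ℝ) ≤ d := by exact_mod_cast hd
  have hdpow : 0 < (d : ℝ) ^ (3 * N) := by positivity
  rcases le_or_gt C 0 with hC | hC
  · have : C * 2 ^ (N + 1)! ≤ 0 := mul_nonpos_iff.mpr (Or.inr ⟨hC, by positivity⟩)
    linarith
  -- `C > 0`
  obtain ⟨t, rfl⟩ : ∃ t, N = t + 6 := ⟨N - 6, by omega⟩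
  have hGN := hN₂ (t + 6) (le_trans (le_max_left _ _) hN)
  set W : ℝ := (2 : ℝ) ^ (t + 6)! with hW
  have hWpos : 0 < W := by positivity
  have hhalf : (1 / 2 : ℝ) ^ (t + 6)! = W⁻¹ := by rw [hW, one_div_pow, one_div]
  -- `W² < c² d^5`
  have hx2 : x ^ 2 ≤ c ^ 2 * W⁻¹ ^ 2 := by
    rw [← mul_pow, ← hhalf]; exact pow_le_pow_left₀ hx0 hx 2
  have hW2 : W ^ 2 < c ^ 2 * (d : ℝ) ^ 5 := by
    have h1 : 1 < (d : ℝ) ^ 5 * (c ^ 2 * W⁻¹ ^ 2) := lt_of_lt_of_le hnot (by gcongr)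
    rw [inv_pow, ← div_eq_mul_inv, ← mul_div_assoc, lt_div_iff₀ (by positivity), one_mul] at h1
    linarith
  -- the goal, by contradiction
  have hfac : (2 : ℝ) ^ (t + 6 + 1)! = W ^ (t + 7) := by
    rw [hW, ← pow_mul, show t + 6 + 1 = t + 7 by rfl, Nat.factorial_succ, mul_comm]
  rw [hfac]
  by_contra hge
  push Not at hge
  -- `d^{15N} ≤ C^5 W^{5(N+1)}`
  have h5 : ((d : ℝ) ^ (3 * (t + 6))) ^ 5 ≤ (C * W ^ (t + 7)) ^ 5 := pow_le_pow_left₀ hdpow.le hge 5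
  -- `W^{6N} < c^{6N} d^{15 N}`
  have h6 : (W ^ 2) ^ (3 * (t + 6)) < (c ^ 2 * (d : ℝ) ^ 5) ^ (3 * (t + 6)) :=
    pow_lt_pow_left₀ hW2 (by positivity) (by omega)
  have h7 : (c ^ 2 * (d : ℝ) ^ 5) ^ (3 * (t + 6)) = c ^ (6 * (t + 6)) * ((d : ℝ) ^ (3 * (t + 6))) ^ 5 := by
    rw [mul_pow, ← pow_mul, ← pow_mul, ← pow_mul]; ring_nf
  have h8 : (W ^ 2) ^ (3 * (t + 6)) = W ^ (t + 1) * W ^ (5 * (t + 7)) := by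
    rw [← pow_mul, ← pow_add]; ring_nf
  have h9 : (C * W ^ (t + 7)) ^ 5 = C ^ 5 * W ^ (5 * (t + 7)) := by rw [mul_pow, ← pow_mul, mul_comm (t + 7)]
  rw [h7] at h6
  rw [h9] at h5
  have h10 : W ^ (t + 1) * W ^ (5 * (t + 7)) < c ^ (6 * (t + 6)) * (C ^ 5 * W ^ (5 * (t + 7))) := by
    have hc6 : 0 ≤ c ^ (6 * (t + 6)) := by rw [pow_mul]; exact pow_nonneg (by positivity) _
    rw [← h8]; exact h6.trans_le (mul_le_mul_of_nonneg_left h5 hc6)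
  have h11 : W ^ (t + 1) < c ^ (6 * (t + 6)) * C ^ 5 := by
    have hp : 0 < W ^ (5 * (t + 7)) := by positivity
    nlinarith
  -- but `c^{6N} C^5 ≤ G^{N+1} ≤ 2^{(N-5) N!} = W^{t+1}`
  have hG1 : 1 ≤ G := le_max_left _ _
  have hcG : c ^ (6 * (t + 6)) ≤ G ^ (t + 6) := by
    rw [pow_mul]
    exact pow_le_pow_left₀ (by positivity) ((le_max_right _ _).trans (le_max_right _ _)) _
  have hCG : C ^ 5 ≤ G := (le_max_left _ _).trans (le_max_right _ _)
  have h12 : c ^ (6 * (t + 6)) * C ^ 5 ≤ G ^ (t + 6 + 1) := by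
    rw [pow_succ]
    exact mul_le_mul hcG hCG (pow_nonneg hC.le 5) (pow_nonneg (zero_le_one.trans hG1) _)
  have h13 : (2 : ℝ) ^ ((t + 6 - 5) * (t + 6)!) = W ^ (t + 1) := by
    rw [hW, ← pow_mul, show t + 6 - 5 = t + 1 by omega, mul_comm]
  linarith [h13 ▸ hGN]

end Summit.Schanuel.Schanuel.Theorems.RootDecomp1KXLinearII

end
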